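import Summits.AtomisticToContinuum.HydrodynamicLimit.Theorems.CollisionIsometryCLTCollisionalTransferLocalityWeightedKineticRelaxation
import HarnessLib

/-!
# Time-local `(Z−1)`-weighted weak kinetic relaxation [C-loc]
(registered stub `stub_weightedKineticRelaxationAt`)

Stub [C-loc] of the line `hemisphere-affine-slaving` for the crux `CollisionalTransferLocality`
(stmt-AtomisticToContinuum-9518): the landed [C] `stub_weightedKineticRelaxation` with its kinetic
hypothesis cut down from `FMRAt σ a₀ θ₀ u₀` (the conclusion of the `∀ t` hinge 9522 at ALL flows,
kernels and horizons) to the kinetic closure at THE GIVEN `(Φ, kernel φ, t)` —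
`∫₀ᵗ∫ (Σ D² + |q|²) → 0` in local-Gibbs probability — which is all the landed proof uses.
Given Ruelle convexity (`HsFreeEnergyConvex`, by name), nice profiles, `σ > 0`, a flow family,
`t > 0` with the time-averaged exponential velocity moment `ExpMomAt`, an admissible kernel family
with the density window `WindowAt`, the local kinetic closure and smooth tests: `RelaxC`, i.e.
`K_N(z, τ) = ∫₀^τ∫ kinW · p_c(ρ̄, θ̄) → 0` in probability uniformly in `τ ≤ t`.

Proof: verbatim the landed one (`…WeightedKineticRelaxation`): on the good set off the window /
moment / kinetic-closure bad events, `sup_τ |K_N| ≤ 2δ/3` by `abs_Kfun_le` with `ε`, then the closure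
level `δ'`, chosen from `δ`; `energy_le_expMoment` converts the exponential moment into the energy
bound; union bound (`measure_le_of_imp3`) and squeeze. Sources: Chapman–Cowling 1970 §16.4;
Spohn 1991 I §3.
-/

namespace Summit.AtomisticToContinuum.HydrodynamicLimit.Theorems.HemisphereAffineSlaving

open scoped BigOperators Topology Classical MeasureTheory ENNReal
open Filter Set Function TopologicalSpace MeasureTheory

noncomputable section

open Literature.MathematicalPhysics.KineticTheory (T3 V3 hsCompressibility hsPressure localGibbsLaw)
open Literature.Analysis.FluidPDE (empiricalMeasure integral_empiricalMeasure configEnergy)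

/-- **Registered stub `stub_weightedKineticRelaxationAt`** ([C-loc], the time-local `(Z−1)`-weighted
weak kinetic relaxation) of crux stmt-AtomisticToContinuum-9518 (line hemisphere-affine-slaving):
Ruelle convexity (`HsFreeEnergyConvex`), the time-averaged exponential velocity moment `ExpMomAt`,
the density window `WindowAt` and the kinetic closure `∫₀ᵗ∫ (Σ D² + |q|²) → 0` in probability AT the
given `(Φ, φ, t)` imply `RelaxC`: `K_N(z, τ) → 0` in local-Gibbs probability uniformly in `τ ≤ t`
(on the good set off the window / moment / closure bad events, `sup_τ |K_N| ≤ 2δ/3` by `abs_Kfun_le`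
with `ε`, `δ'` chosen from `δ`; union bound). [folklore] -/
theorem stub_weightedKineticRelaxationAt :
    Summit.AtomisticToContinuum.HydrodynamicLimit.Theses.StiffCollisionalRelaxation.HsFreeEnergyConvex →
    ∀ (a₀ θ₀ : T3 → ℝ) (u₀ : T3 → V3), NiceProfiles a₀ θ₀ u₀ →
      ∀ σ : ℝ, 0 < σ → ∀ (Φ : Flows σ) (t : ℝ), 0 < t → ExpMomAt σ a₀ θ₀ u₀ Φ t →
        ∀ (γ C : ℝ) (φ : ℕ → T3 → ℝ), 0 < γ → γ ≤ 1 / 15 → AdmissibleKernel γ C φ →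
          WindowAt σ a₀ θ₀ u₀ Φ t φ →
          (∀ δ : ℝ, 0 < δ → Tendsto (fun N : ℕ =>
            Literature.MathematicalPhysics.KineticTheory.localGibbsLaw σ a₀ u₀ θ₀ N (Φ N)
              {z | δ < ∫ s in Icc 0 t, ∫ x, ((∑ j, ∑ k, Dst φ N ((Φ N).flow s z) x j k ^ 2) +
                ‖qfl φ N ((Φ N).flow s z) x‖ ^ 2)}) atTop (𝓝 0)) →
          ∀ (ψ : ℝ → T3 → V3) (χ : ℝ → T3 → ℝ),
            Literature.Analysis.FunctionSpaces.Torus.IsSmoothSpaceTimeOn (Icc 0 t) ψ →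
            Literature.Analysis.FunctionSpaces.Torus.IsSmoothSpaceTimeOn (Icc 0 t) χ →
            RelaxC σ a₀ θ₀ u₀ Φ φ t ψ χ := by
  intro hH a₀ θ₀ u₀ _ σ hσ Φ t ht hExp γ C φ _hγ _hγ' hadm hWin hFMR ψ χ hψ hχ δ hδ
  obtain ⟨lam, Cexp, hlam, hExpT⟩ := hExp
  obtain ⟨c₁, hc₁, hWinT⟩ := hWin
  obtain ⟨CZ, hCZ0, hCZ⟩ := abs_hsCompressibility_sub_one_le hH σ hσ c₁ hc₁
  obtain ⟨Ct, hCt0, hCtψ, hCtχ⟩ := exists_grad_bound ht hψ hχ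
  set K : ℝ := CZ * Ct + 1 with hK
  have hK0 : 0 < K := by positivity
  set A₀ : ℝ := 12 * t + 12 * |Cexp| / (c₁ * lam) with hA₀
  have hA₀0 : 0 < A₀ := by positivity
  set ε : ℝ := δ / (3 * K * A₀) with hε
  have hε0 : 0 < ε := by positivity
  set δ' : ℝ := δ * ε / (63 * K) with hδ'
  have hδ'0 : 0 < δ' := by positivity
  have hF : Tendsto (fun N : ℕ => localGibbsLaw σ a₀ u₀ θ₀ N (Φ N)
      {z | δ' < ∫ s in Icc 0 t, ∫ x,
        ((∑ j, ∑ k, Dst φ N ((Φ N).flow s z) x j k ^ 2) +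
          ‖qfl φ N ((Φ N).flow s z) x‖ ^ 2)}) atTop (𝓝 0) :=
    hFMR δ' hδ'0
  have hlim : Tendsto (fun N : ℕ =>
      localGibbsLaw σ a₀ u₀ θ₀ N (Φ N) {z | ∃ s ∈ Icc 0 t, ∃ x : UnitAddTorus (Fin 3),
        Literature.MathematicalPhysics.KineticTheory.empiricalDensityField ((Φ N).flow s z)
          (fun y => φ N (y - x)) < c₁ ∨
        1 < Literature.MathematicalPhysics.KineticTheory.empiricalDensityField ((Φ N).flow s z)
          (fun y => φ N (y - x)) * σ ^ 3} +
      (localGibbsLaw σ a₀ u₀ θ₀ N (Φ N) {z | Cexp < ∫ s in Icc 0 t, ∫ y, Real.exp (lam * ‖y.2‖ ^ 2)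
          ∂(empiricalMeasure ((Φ N).flow s z))} +
        localGibbsLaw σ a₀ u₀ θ₀ N (Φ N)
          {z | δ' < ∫ s in Icc 0 t, ∫ x,
            ((∑ j, ∑ k, Dst φ N ((Φ N).flow s z) x j k ^ 2) +
              ‖qfl φ N ((Φ N).flow s z) x‖ ^ 2)})) atTop (𝓝 0) := by
    simpa using hWinT.add (hExpT.add hF)
  refine tendsto_of_tendsto_of_tendsto_of_le_of_le tendsto_const_nhds hlim (fun N => zero_le)
    fun N => ?_
  -- the union bound at fixed `N`
  have hφc : Continuous (φ N) := (hadm.1 N).continuous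
  have hφ0 : ∀ y, 0 ≤ φ N y := hadm.2.1 N
  have hφ1 : ∫ y, φ N y = 1 := hadm.2.2.1 N
  have hφb : ∀ y, φ N y ≤ C * ((N : ℝ) + 1) ^ (3 * γ) := hadm.2.2.2.2.1 N
  refine measure_le_of_imp3 _ (localGibbsLaw_compl_good' (Φ N)) fun z hz hzg hw hexp => ?_
  by_contra hfmr
  simp only [Set.mem_setOf_eq, not_exists, not_or, not_lt, not_and] at hw hexp hfmr hz
  obtain ⟨τ, hτ, hτδ⟩ := hz
  have hwin : ∀ s ∈ Icc 0 t, ∀ x, c₁ ≤ rhoB φ N ((Φ N).flow s z) x ∧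
      rhoB φ N ((Φ N).flow s z) x * σ ^ 3 ≤ 1 := fun s hs x => hw s hs x
  have hKf := abs_Kfun_le Φ hzg hφc hφ0 hφ1 hφb hc₁ hε0 hCt0 hCZ0 hCZ hCtψ hCtχ hwin hτ
  have hEn := energy_le_expMoment Φ hzg hlam ht.le
  set e := ((N + 1 : ℕ) : ℝ)⁻¹ * configEnergy z with he
  set I := ∫ s in Icc 0 t, ∫ x, ((∑ j, ∑ k, Dst φ N ((Φ N).flow s z) x j k ^ 2) +
    ‖qfl φ N ((Φ N).flow s z) x‖ ^ 2) with hI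
  have hI0 : 0 ≤ I := integral_nonneg fun s => integral_nonneg fun x => by positivity
  have he0 : 0 ≤ e := mul_nonneg (by positivity) (by unfold configEnergy; positivity)
  have het : e * t ≤ |Cexp| / (2 * lam) := by
    rw [le_div_iff₀ (by positivity)]
    nlinarith [hEn.trans (hexp.trans (le_abs_self Cexp))]
  have hKK : CZ * Ct ≤ K := by rw [hK]; linarith
  have h1 : (CZ * Ct * (12 * ε) + CZ * Ct * (24 * ε / c₁) * e) * t ≤ δ / 3 := by
    calc (CZ * Ct * (12 * ε) + CZ * Ct * (24 * ε / c₁) * e) * t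
        = CZ * Ct * ε * (12 * t + 24 / c₁ * (e * t)) := by ring
      _ ≤ K * ε * (12 * t + 24 / c₁ * (|Cexp| / (2 * lam))) := by gcongr
      _ = K * ε * A₀ := by rw [hA₀]; field_simp; ring
      _ = δ / 3 := by rw [hε]; field_simp
  have h2 : CZ * Ct * (21 / ε) * I ≤ δ / 3 := by
    calc CZ * Ct * (21 / ε) * I ≤ K * (21 / ε) * δ' := by gcongr
      _ = δ / 3 := by rw [hδ']; field_simp; ring
  linarith

end

end Summit.AtomisticToContinuum.HydrodynamicLimit.Theorems.HemisphereAffineSlaving
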